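import Literature.Analysis.Complex.BacklundArgVariation
import HarnessLib

/-!
# The order of `Q + Q♯` at a zero of `Q` on the line of reflection

Trunk T-ANALYSIS support (`Literature/Analysis/Complex`). For a vertical line `Re s = a` and a
function `Q`, put `Q♯(s) = conj Q(2a − s̄)` (reflection in the line: `s ↦ 2a − s̄` fixes
`a + it`; for `a = ½` it is `s ↦ 1 − s̄`). On the line, `Q♯ = conj Q`, so `Q + Q♯ = 2 Re Q` there.
This is the mechanism of Levinson's method in Conrey's arrangement: `K ξ(s) = Q(s) + Q♯(s)`
(J. B. Conrey, *J. Number Theory* 16 (1983), §4, (1)), so that the zeros of `ξ` on the critical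
line are the points where `Re Q = 0`, together with the zeros of `Q` itself ("by (1) such a
point is a zero of `ξ` of multiplicity at least `n`").

We prove the local statement behind the quoted sentence, including the refinement needed to
make the count honest (`Literature.Analysis.Complex.exists_finset_cos_jumpPhase_eq_zero` flags
exactly this case): if `Q(s) = (s − ρ)ⁿ g(s)` near `ρ = a + it₀` with `g` analytic and
`g(ρ) ≠ 0`, then near `ρ`

  `Q + Q♯ = (s − ρ)ⁿ · (g + (−1)ⁿ g♯)`,

so `Q + Q♯` is analytic at `ρ` with order `≥ n` (`natCast_le_analyticOrderAt_add_reflect`), and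
with order `≥ n + 1` precisely when `g(ρ) + (−1)ⁿ conj g(ρ) = 0`, i.e. when
`Re ((−i)ⁿ g(ρ)) = 0` (`succ_le_analyticOrderAt_add_reflect`) — the condition that the one-sided
arguments of `Q` along the line at `t₀` (`arg g(ρ) ∓ nπ/2`) are `≡ π/2 (mod π)`.

## Main results

* `analyticAt_reflect` — `Q♯` is analytic at `s` when `Q` is analytic at `2a − s̄`.
* `reflect_eventuallyEq` — `Q♯ = (−1)ⁿ (s − ρ)ⁿ g♯` near `ρ`.
* `natCast_le_analyticOrderAt_add_reflect`, `succ_le_analyticOrderAt_add_reflect`,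
  `re_neg_I_pow_mul_eq_zero_iff` — the statements above.

## References

* J. B. Conrey, *Zeros of derivatives of Riemann's ξ-function on the critical line*, J. Number
  Theory 16 (1983), 49–74, §4 (1). [Conrey1983]
-/

noncomputable section

open Complex Filter Topology
open scoped ComplexConjugate

namespace Literature.Analysis.Complex

/-- The reflection `s ↦ 2a − s̄` in the line `Re s = a` is continuous. [folklore] -/
theorem continuous_reflect (a : ℝ) : Continuous fun s : ℂ ↦ (2 * a : ℂ) - conj s := by
  fun_prop

/-- The reflection fixes the points of the line: `2a − conj (a + it) = a + it`. [folklore] -/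
theorem reflect_ofReal_add_mul_I (a t : ℝ) : (2 * a : ℂ) - conj ((a : ℂ) + t * I) = a + t * I := by
  simp only [map_add, map_mul, Complex.conj_ofReal, Complex.conj_I]
  ring

/-- `2a − s̄ = conj (2a − s)` for real `a`. [folklore] -/
theorem reflect_eq_conj (a : ℝ) (s : ℂ) : (2 * a : ℂ) - conj s = conj ((2 * a : ℂ) - s) := by
  simp only [map_sub, map_mul, map_ofNat, Complex.conj_ofReal]

/-- **`Q♯(s) = conj Q(2a − s̄)` is analytic** at `s` if `Q` is analytic at `2a − s̄`
(an anti-holomorphic map composed with `conj`). [folklore] -/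
theorem analyticAt_reflect {Q : ℂ → ℂ} {a : ℝ} {s : ℂ} (hQ : AnalyticAt ℂ Q ((2 * a : ℂ) - conj s)) :
    AnalyticAt ℂ (fun w : ℂ ↦ conj (Q ((2 * a : ℂ) - conj w))) s := by
  have h1 : AnalyticAt ℂ (fun w : ℂ ↦ conj (Q (conj w))) ((2 * a : ℂ) - s) := by
    refine analyticAt_conj_comp_conj ?_
    rwa [← reflect_eq_conj]
  have h2 : AnalyticAt ℂ (fun w : ℂ ↦ (2 * a : ℂ) - w) s := analyticAt_const.sub analyticAt_id
  have h := h1.comp h2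
  refine h.congr (Eventually.of_forall fun w ↦ ?_)
  simp only [Function.comp_apply, reflect_eq_conj]

/-- **The reflected function near a zero on the line.** If `Q(s) = (s − ρ)ⁿ g(s)` near
`ρ = a + it₀`, then near `ρ`, `Q♯(s) = (−1)ⁿ (s − ρ)ⁿ g♯(s)` with `g♯(s) = conj g(2a − s̄)`
(`conj (2a − s̄ − ρ) = −(s − ρ)` because `ρ` is on the line). [folklore] -/
theorem reflect_eventuallyEq {Q g : ℂ → ℂ} {a t₀ : ℝ} {n : ℕ}
    (hQ : ∀ᶠ z in 𝓝 ((a : ℂ) + t₀ * I), Q z = (z - (a + t₀ * I)) ^ n * g z) :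
    ∀ᶠ s in 𝓝 ((a : ℂ) + t₀ * I),
      conj (Q ((2 * a : ℂ) - conj s)) =
        (-1) ^ n * (s - (a + t₀ * I)) ^ n * conj (g ((2 * a : ℂ) - conj s)) := by
  have ht : Tendsto (fun s : ℂ ↦ (2 * a : ℂ) - conj s) (𝓝 ((a : ℂ) + t₀ * I))
      (𝓝 ((a : ℂ) + t₀ * I)) := by
    have h := (continuous_reflect a).tendsto ((a : ℂ) + t₀ * I)
    rwa [reflect_ofReal_add_mul_I] at h
  filter_upwards [ht.eventually hQ] with s hs
  rw [hs, map_mul, map_pow]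
  have e : conj ((2 * a : ℂ) - conj s - (a + t₀ * I)) = -(s - (a + t₀ * I)) := by
    simp only [map_sub, map_add, map_mul, map_ofNat, Complex.conj_conj, Complex.conj_ofReal,
      Complex.conj_I]
    ring
  rw [e, neg_pow]

/-- **`Q + Q♯` vanishes to order `≥ n` at a zero of `Q` of order `n` on the line** (it is analytic
there, and equals `(s − ρ)ⁿ (g + (−1)ⁿ g♯)` near `ρ`). [cite: Conrey1983, §4 (after (1))] -/
theorem natCast_le_analyticOrderAt_add_reflect {Q g : ℂ → ℂ} {a t₀ : ℝ} {n : ℕ}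
    (hg : AnalyticAt ℂ g ((a : ℂ) + t₀ * I))
    (hQ : ∀ᶠ z in 𝓝 ((a : ℂ) + t₀ * I), Q z = (z - (a + t₀ * I)) ^ n * g z) :
    AnalyticAt ℂ (fun s : ℂ ↦ Q s + conj (Q ((2 * a : ℂ) - conj s))) ((a : ℂ) + t₀ * I) ∧
      (n : ℕ∞) ≤ analyticOrderAt (fun s : ℂ ↦ Q s + conj (Q ((2 * a : ℂ) - conj s))) ((a : ℂ) + t₀ * I) := by
  set ρ : ℂ := (a : ℂ) + t₀ * I with hρ
  -- `g♯` and `h = g + (-1)^n g♯`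
  have hg' : AnalyticAt ℂ (fun s : ℂ ↦ conj (g ((2 * a : ℂ) - conj s))) ρ := by
    refine analyticAt_reflect ?_
    rwa [hρ, reflect_ofReal_add_mul_I]
  set h : ℂ → ℂ := fun s ↦ g s + (-1) ^ n * conj (g ((2 * a : ℂ) - conj s)) with hh
  have hh_an : AnalyticAt ℂ h ρ := hg.add (analyticAt_const.mul hg')
  have hpow_an : AnalyticAt ℂ (fun s : ℂ ↦ (s - ρ) ^ n) ρ := (analyticAt_id.sub analyticAt_const).pow n
  -- `Q + Q♯ = (s - ρ)^n h` near `ρ`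
  have hev : (fun s : ℂ ↦ Q s + conj (Q ((2 * a : ℂ) - conj s))) =ᶠ[𝓝 ρ]
      fun s ↦ (s - ρ) ^ n * h s := by
    filter_upwards [hQ, reflect_eventuallyEq hQ] with s hs hs'
    rw [hs, hs', hh]
    ring
  have han : AnalyticAt ℂ (fun s : ℂ ↦ Q s + conj (Q ((2 * a : ℂ) - conj s))) ρ :=
    (hpow_an.mul hh_an).congr hev.symm
  refine ⟨han, ?_⟩
  have horder_pow : analyticOrderAt (fun s : ℂ ↦ (s - ρ) ^ n) ρ = n := by
    rw [hpow_an.analyticOrderAt_eq_natCast]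
    exact ⟨1, analyticAt_const, one_ne_zero, Eventually.of_forall fun s ↦ by simp⟩
  rw [analyticOrderAt_congr hev]
  change (n : ℕ∞) ≤ analyticOrderAt ((fun s : ℂ ↦ (s - ρ) ^ n) * h) ρ
  rw [analyticOrderAt_mul hpow_an hh_an, horder_pow]
  exact le_self_add

/-- `Re ((−i)ⁿ w) = 0 ↔ w + (−1)ⁿ conj w = 0`. [folklore] -/
theorem re_neg_I_pow_mul_eq_zero_iff (n : ℕ) (w : ℂ) :
    ((-I) ^ n * w).re = 0 ↔ w + (-1) ^ n * conj w = 0 := by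
  -- `2 Re((-i)^n w) = (-i)^n w + i^n conj w = (-i)^n (w + (-1)^n conj w)`
  have hkey : (2 * (((-I) ^ n * w).re : ℂ)) = (-I) ^ n * (w + (-1) ^ n * conj w) := by
    rw [Complex.re_eq_add_conj, map_mul, map_pow, map_neg, Complex.conj_I, neg_neg]
    have hI : (I : ℂ) ^ n = (-I) ^ n * (-1) ^ n := by rw [← mul_pow]; ring_nf
    rw [hI]
    ring
  have hu : ((-I : ℂ) ^ n) ≠ 0 := pow_ne_zero _ (neg_ne_zero.2 I_ne_zero)
  constructor
  · intro h0
    have : (-I : ℂ) ^ n * (w + (-1) ^ n * conj w) = 0 := by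
      rw [← hkey, h0]; simp
    exact (mul_eq_zero.1 this).resolve_left hu
  · intro h0
    have h2 : (2 * (((-I) ^ n * w).re : ℂ)) = 0 := by rw [hkey, h0, mul_zero]
    have h3 : (((-I) ^ n * w).re : ℂ) = 0 := by
      rcases mul_eq_zero.1 h2 with h | h
      · norm_num at h
      · exact h
    exact_mod_cast h3

/-- **Order `≥ n + 1` in the flagged case.** With `Q(s) = (s − ρ)ⁿ g(s)` near `ρ = a + it₀`,
`g` analytic at `ρ`, if `Re ((−i)ⁿ g(ρ)) = 0` — equivalently `g(ρ) + (−1)ⁿ conj g(ρ) = 0`, the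
value at `ρ` of the cofactor `g + (−1)ⁿ g♯` — then `Q + Q♯` vanishes at `ρ` to order `≥ n + 1`.
(Along the line, `arg Q(a + it) → arg g(ρ) − nπ/2` as `t ↑ t₀`; the hypothesis says this limit
is `≡ π/2 (mod π)`.) [cite: Conrey1983, §4 (after (1))] -/
theorem succ_le_analyticOrderAt_add_reflect {Q g : ℂ → ℂ} {a t₀ : ℝ} {n : ℕ}
    (hg : AnalyticAt ℂ g ((a : ℂ) + t₀ * I))
    (hQ : ∀ᶠ z in 𝓝 ((a : ℂ) + t₀ * I), Q z = (z - (a + t₀ * I)) ^ n * g z)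
    (hflag : ((-I) ^ n * g ((a : ℂ) + t₀ * I)).re = 0) :
    ((n + 1 : ℕ) : ℕ∞) ≤
      analyticOrderAt (fun s : ℂ ↦ Q s + conj (Q ((2 * a : ℂ) - conj s))) ((a : ℂ) + t₀ * I) := by
  set ρ : ℂ := (a : ℂ) + t₀ * I with hρ
  have hg' : AnalyticAt ℂ (fun s : ℂ ↦ conj (g ((2 * a : ℂ) - conj s))) ρ := by
    refine analyticAt_reflect ?_
    rwa [hρ, reflect_ofReal_add_mul_I]
  set h : ℂ → ℂ := fun s ↦ g s + (-1) ^ n * conj (g ((2 * a : ℂ) - conj s)) with hh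
  have hh_an : AnalyticAt ℂ h ρ := hg.add (analyticAt_const.mul hg')
  have hpow_an : AnalyticAt ℂ (fun s : ℂ ↦ (s - ρ) ^ n) ρ := (analyticAt_id.sub analyticAt_const).pow n
  have hev : (fun s : ℂ ↦ Q s + conj (Q ((2 * a : ℂ) - conj s))) =ᶠ[𝓝 ρ]
      fun s ↦ (s - ρ) ^ n * h s := by
    filter_upwards [hQ, reflect_eventuallyEq hQ] with s hs hs'
    rw [hs, hs', hh]
    ring
  have horder_pow : analyticOrderAt (fun s : ℂ ↦ (s - ρ) ^ n) ρ = n := by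
    rw [hpow_an.analyticOrderAt_eq_natCast]
    exact ⟨1, analyticAt_const, one_ne_zero, Eventually.of_forall fun s ↦ by simp⟩
  -- the cofactor vanishes at `ρ`
  have hhρ : h ρ = 0 := by
    have := (re_neg_I_pow_mul_eq_zero_iff n (g ρ)).1 hflag
    simp only [hh, hρ, reflect_ofReal_add_mul_I]
    exact this
  have horder_h : (1 : ℕ∞) ≤ analyticOrderAt h ρ := by
    rw [Order.one_le_iff_ne_zero]
    intro h0
    exact (hh_an.analyticOrderAt_eq_zero.1 h0) hhρ
  rw [analyticOrderAt_congr hev]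
  change ((n + 1 : ℕ) : ℕ∞) ≤ analyticOrderAt ((fun s : ℂ ↦ (s - ρ) ^ n) * h) ρ
  rw [analyticOrderAt_mul hpow_an hh_an, horder_pow]
  push_cast
  exact add_le_add_right horder_h _

end Literature.Analysis.Complex

end
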